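import Literature.Topology.FourManifolds.BasinSetting
import HarnessLib

/-!
# The basin setting: the push of `∂W` to the level `L` along the trajectories

Topic `Literature/Topology/FourManifolds`; second file of the endgame of the Torelli half of
Griffiths' handlebody theorem (`BasinSetting.lean`: the data; here: the push).  Everything here
is **proved**.

In a basin setting `B : BasinSetting g ξ` (`W` compact with boundary, `g` Morse on
`(W; ∅, ∂W)`, `ξ` gradient-like, `p₀` the unique critical point of index `0`, collar `S` of `∂W`
for the turned-about data), the cover `B.Γ` of height `a'` of the flow-out of `∂W` and the
**push** of `RegularIntervalBoundary.lean` (Milnor 1963, Thm. 3.1), written as maps on `W`: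

* `BasinSetting.depth`, `BasinSetting.Fl`, `BasinSetting.push`, `BasinSetting.pull` — the
  depth `1 - g` below `∂W`, the flow-out, the push (smooth, injective, `BasinSetting.range_push`:
  image `{g ≤ L}`, `L = 1 - κ`) and its inverse (smooth on `{g ≤ L}`);
* `BasinSetting.push_coe`, `apply_push_coe` — a boundary point is pushed to `Fl y κ`, on the
  level `L`;
* `BasinSetting.flowsTo_push_coe` — **a boundary point is reached from its push along a
  trajectory segment of `ξ`** (the flow-out runs along `-ξ/ξ(g)`: time change,
  `CollarSetting.flowsTo_Fl`), whence
* `BasinSetting.coe_mem_unstableSet_iff` — **the push preserves the unstable sets** of all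
  critical points (transport along trajectory segments both ways, `FlowsTo.mem_stableSet_right`
  for `-ξ` and `FlowsTo.mem_unstableSet_right`): the basin of `p₀` and the traces of the other
  critical points on `∂W` are read on the level `L`.

## References

* J. Milnor, *Lectures on the h-cobordism theorem*, notes by L. Siebenmann and J. Sondow,
  Princeton Mathematical Notes (1965): Def. 3.1, proof of Thm. 3.4 (PDF pp. 11–13), Def. 3.9
  (PDF p. 16), Thm. 4.1 (PDF p. 22), proof of Thm. 5.4, Assertion 4 (PDF p. 29).
  [MilnorHCobordism1965]
* J. Milnor, *Morse theory* (1963), Thm. 3.1 and proof of Thm. 4.1 (p. 25). [Milnor1963]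
* H. B. Griffiths, *Automorphisms of a 3-dimensional handlebody*, Abh. Math. Sem. Univ. Hamburg
  26 (1964), §§3–6. [GriffithsHB1964Handlebody]
-/

open scoped Manifold ContDiff Topology
open Set Function Filter Metric

noncomputable section

namespace Literature.Topology.FourManifolds

open Cobordism FourManifolds.Flow

universe u

variable {n : ℕ} {W : Type u} [TopologicalSpace W] [T2Space W] [SecondCountableTopology W]
  [CompactSpace W] [ChartedSpace (EuclideanHalfSpace (n + 1)) W] [IsManifold (𝓡∂ (n + 1)) ∞ W]

/-! ### The push of `∂W` to the level `L` along the trajectories -/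

namespace BasinSetting

variable {g : W → ℝ} {ξ : Π x : W, TangentSpace (𝓡∂ (n + 1)) x} (B : BasinSetting g ξ)

/-- **The cover of height `a'`** of the flow-out of `∂W` (same boxes as the collar setting's
cover, height lowered to `a'`), whose push has depth `κ`. [cite: Milnor1963, Thm. 3.1] -/
def Γ : B.S.D.Cover := B.S.Γ.withHeight B.S.a' B.S.a'_pos B.S.a'_lt.le

/-- The height of `Γ` is `a'`. [folklore] -/
@[simp] theorem Γ_a : B.Γ.a = B.S.a' := rfl

/-- **The push depth of `Γ` is `κ`.** [folklore] -/
theorem pushDepth_eq : B.Γ.pushDepth = B.κ := by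
  unfold FlowoutInput.Cover.pushDepth FlowoutInput.Cover.pushLen κ
  rw [Γ_a]; ring

/-- **The depth** below `∂W`: the boundary-defining function of the collar (`= 1 - g` near
`∂W`), as a function on `W`. [cite: MilnorHCobordism1965, proof of Thm. 3.4 (PDF pp. 12–13)] -/
def depth (z : W) : ℝ := B.S.D.f z

/-- **The flow-out** of the collar of `∂W` (Milnor's `ψ_z(s)`, depth parametrisation), as a map
on `W`. [cite: MilnorHCobordism1965, proof of Thm. 3.4 (PDF pp. 12–13)] -/
def Fl (z : W) (t : ℝ) : W := B.S.Γ.Fl z t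

/-- **The push** of `RegularIntervalBoundary.lean` for the cover `Γ`, as a map `W → W`: it moves
`∂W` inward to the level `L` along the trajectories and is the identity below depth `a'/2`.
[cite: Milnor1963, Thm. 3.1] -/
def push (z : W) : W := B.Γ.push z

/-- **The pull**, inverse of the push on its image. [cite: Milnor1963, Thm. 3.1] -/
def pull (z : W) : W := B.Γ.pull z

/-- Unfolding `depth`. [folklore] -/
theorem depth_def (z : W) : B.depth z = B.S.D.f z := rfl

/-- Unfolding `push`. [folklore] -/
theorem push_def (z : W) : B.push z = B.Γ.push z := rfl

/-- Unfolding `pull`. [folklore] -/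
theorem pull_def (z : W) : B.pull z = B.Γ.pull z := rfl

/-- Unfolding `Fl`. [folklore] -/
theorem Fl_def (z : W) (t : ℝ) : B.Fl z t = B.S.Γ.Fl z t := rfl

/-- The depth is `levelProfile (1 - g)`. [folklore] -/
theorem depth_eq_levelProfile (z : W) : B.depth z = levelProfile (1 - g z) := B.S.f_eq z

/-- `1 - g z ≤ 1/4` forces `depth z = 1 - g z`. [folklore] -/
theorem depth_eq_of_le {z : W} (hz : 1 - g z ≤ 1 / 4) : B.depth z = 1 - g z := B.S.Df_eq hz

/-- **Points of depth `≤ a'` lie in the top collar**: `depth z ≤ a'` forces `depth z = 1 - g z`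
(the alternative `g z ≤ a'` of `le_or_le_of_Df_le` is excluded since `a' < g p₀ ≤ g z`). [folklore] -/
theorem depth_eq_of_depth_le {z : W} (hz : B.depth z ≤ B.S.a') : B.depth z = 1 - g z := by
  rcases B.S.le_or_le_of_Df_le hz with h | h
  · exact B.depth_eq_of_le (le_trans h (by linarith [B.a'_le]))
  · exfalso
    have h1 : g z ≤ B.S.a' := by change 1 - B.S.a' ≤ 1 - g z at h; linarith
    exact absurd (B.a'_lt_apply_p₀.trans_le (B.apply_p₀_le z)) (not_lt.2 h1)

/-- On `∂W` the depth vanishes. [folklore] -/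
theorem depth_coe (y : (𝓡∂ (n + 1)).boundary W) : B.depth (y : W) = 0 :=
  (B.S.D.f_eq_zero_iff _).2 y.2

include B in
/-- On `∂W`, `g = 1`. [cite: MilnorHCobordism1965, Def. 3.1] -/
theorem apply_coe (y : (𝓡∂ (n + 1)).boundary W) : g (y : W) = 1 := B.isMorseFunction.2.2.1 y

/-- **The image of the push is the sublevel set `{g ≤ L}`.** [cite: Milnor1963, Thm. 3.1] -/
theorem range_push : range B.push = {w | g w ≤ B.L} := by
  have h0 : range B.push = {w : W | B.κ ≤ B.depth w} := by
    rw [← pushDepth_eq]; exact B.Γ.range_push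
  rw [h0]
  ext w
  change B.κ ≤ B.depth w ↔ g w ≤ B.L
  unfold L
  constructor
  · intro hκ
    by_contra hlt
    rw [not_le] at hlt
    have h1 : 1 - g w ≤ 1 / 4 := by linarith [B.κ_le, B.a'_le]
    rw [B.depth_eq_of_le h1] at hκ
    linarith
  · intro hle
    by_cases h1 : 1 - g w ≤ 1 / 4
    · rw [B.depth_eq_of_le h1]; linarith
    · rw [B.depth_eq_levelProfile w]
      refine le_trans ?_ (min_le_levelProfile (1 - g w))
      rw [not_le] at h1
      have h2 := B.κ_lt_apply w
      have h3 : B.κ ≤ 1 / 16 := by linarith [B.κ_le, B.a'_le]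
      rw [le_min_iff]
      constructor <;> linarith

/-- **The push is smooth.** [cite: Milnor1963, Thm. 3.1] -/
theorem contMDiff_push : ContMDiff (𝓡∂ (n + 1)) (𝓡∂ (n + 1)) ∞ B.push := B.Γ.contMDiff_push

/-- **The push is injective.** [cite: Milnor1963, Thm. 3.1] -/
theorem injective_push : Injective B.push := B.Γ.injective_push

/-- **The pull is smooth on `{g ≤ L}`.** [cite: Milnor1963, Thm. 3.1] -/
theorem contMDiffOn_pull : ContMDiffOn (𝓡∂ (n + 1)) (𝓡∂ (n + 1)) ∞ B.pull {w | g w ≤ B.L} := by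
  have h : ContMDiffOn (𝓡∂ (n + 1)) (𝓡∂ (n + 1)) ∞ B.pull {w : W | B.Γ.pushDepth ≤ B.depth w} :=
    B.Γ.contMDiffOn_pull
  have h0 : {w : W | B.Γ.pushDepth ≤ B.depth w} = range B.push := B.Γ.range_push.symm
  rwa [h0, range_push] at h

/-- `pull ∘ push = id`. [folklore] -/
theorem pull_push (z : W) : B.pull (B.push z) = z := B.Γ.pull_push z

/-- `push ∘ pull = id` on `{g ≤ L}`. [folklore] -/
theorem push_pull {w : W} (hw : g w ≤ B.L) : B.push (B.pull w) = w := by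
  have : w ∈ range B.push := by rw [range_push]; exact hw
  obtain ⟨z, rfl⟩ := this
  rw [pull_push]

/-- `g (push z) ≤ L` for every `z`. [folklore] -/
theorem apply_push_le (z : W) : g (B.push z) ≤ B.L := by
  have : B.push z ∈ range B.push := mem_range_self z
  rw [range_push] at this
  exact this

/-- `pull` maps `{g ≤ L}` bijectively onto `W`; in particular distinct points of `{g ≤ L}` have
distinct pulls. [folklore] -/
theorem pull_injOn : InjOn B.pull {w | g w ≤ B.L} := fun w hw w' hw' h => by
  rw [← B.push_pull hw, ← B.push_pull hw', h]

/-- **The push of a boundary point**: `push y = Fl y κ`. [folklore] -/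
theorem push_coe (y : (𝓡∂ (n + 1)).boundary W) : B.push (y : W) = B.Fl (y : W) B.κ := by
  have hy : B.depth (y : W) ≤ B.Γ.a := by rw [depth_coe, Γ_a]; exact B.a'_pos.le
  have h1 : B.push (y : W) = B.Fl (y : W) (B.Γ.pushTime (B.depth (y : W))) := B.Γ.push_of_le hy
  rw [h1, depth_coe]
  congr 1
  rw [← pushDepth_eq, ← B.Γ.pushShift_zero, B.Γ.pushShift_eq_add, zero_add]

/-- Depth along the flow-out of a boundary point: `depth (Fl y t) = t` for `t ∈ [0, a']`. [folklore] -/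
theorem depth_Fl_coe (y : (𝓡∂ (n + 1)).boundary W) {t : ℝ} (ht : t ∈ Icc 0 B.S.a') :
    B.depth (B.Fl (y : W) t) = t := by
  have hy : B.depth (y : W) ≤ B.S.Γ.a := by rw [depth_coe]; exact B.S.Γ.a_pos.le
  have ht' : t ∈ Icc (-B.depth (y : W)) B.S.Γ.a := by
    rw [depth_coe, neg_zero]; exact ⟨ht.1, ht.2.trans B.S.a'_lt.le⟩
  have h := B.S.Γ.f_Fl hy ht'
  change B.depth (B.Fl (y : W) t) = B.depth (y : W) + t at h
  rw [depth_coe, zero_add] at h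
  exact h

/-- **Level along the flow-out of a boundary point**: `g (Fl y t) = 1 - t` for `t ∈ [0, a']`. [cite: MilnorHCobordism1965, proof of Thm. 3.4 (PDF pp. 12–13)] -/
theorem apply_Fl_coe (y : (𝓡∂ (n + 1)).boundary W) {t : ℝ} (ht : t ∈ Icc 0 B.S.a') :
    g (B.Fl (y : W) t) = 1 - t := by
  have h1 := B.depth_Fl_coe y ht
  have h2 := B.depth_eq_of_depth_le (z := B.Fl (y : W) t) (by rw [h1]; exact ht.2)
  linarith

/-- `κ ∈ [0, a']`. [folklore] -/
theorem κ_mem_Icc : B.κ ∈ Icc 0 B.S.a' := ⟨B.κ_pos.le, by linarith [B.κ_le, B.a'_pos]⟩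

/-- **The push of `∂W` lies on the level `L`.** [cite: Milnor1963, Thm. 3.1] -/
theorem apply_push_coe (y : (𝓡∂ (n + 1)).boundary W) : g (B.push (y : W)) = B.L := by
  rw [push_coe, B.apply_Fl_coe y B.κ_mem_Icc]; rfl

/-- **A boundary point is reached from its flow-out along `ξ`** (the flow-out runs along
`-ξ/ξ(g)`: time change, `CollarSetting.flowsTo_Fl`). [cite: MilnorHCobordism1965, proof of Thm. 3.4 (PDF pp. 12–13)] -/
theorem flowsTo_Fl_coe (y : (𝓡∂ (n + 1)).boundary W) {t : ℝ} (ht : t ∈ Icc 0 B.S.a') :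
    FlowsTo (𝓡∂ (n + 1)) ξ (B.Fl (y : W) t) (y : W) := by
  have h0 : 1 - g (y : W) = 0 := by rw [B.apply_coe y, sub_self]
  have h1 : (fun z : W => 1 - g z) (y : W) ≤ B.S.a' := by
    show 1 - g (y : W) ≤ B.S.a'; rw [h0]; exact B.a'_pos.le
  have h2 : t ∈ Icc 0 (B.S.a' - (fun z : W => 1 - g z) (y : W)) := by
    show t ∈ Icc 0 (B.S.a' - (1 - g (y : W))); rw [h0, sub_zero]; exact ht
  have h := B.S.flowsTo_Fl h1 h2
  exact flowsTo_neg_iff.1 h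

/-- **A boundary point is reached from its push along `ξ`.** [cite: MilnorHCobordism1965, proof of Thm. 3.4 (PDF pp. 12–13)] -/
theorem flowsTo_push_coe (y : (𝓡∂ (n + 1)).boundary W) :
    FlowsTo (𝓡∂ (n + 1)) ξ (B.push (y : W)) (y : W) := by
  rw [push_coe]; exact B.flowsTo_Fl_coe y B.κ_mem_Icc

include B in
/-- `ξ` is `C¹`. [folklore] -/
theorem contMDiff_one : ContMDiff (𝓡∂ (n + 1)) (𝓡∂ (n + 1)).tangent 1
    fun x => (⟨x, ξ x⟩ : TangentBundle (𝓡∂ (n + 1)) W) :=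
  (BasinSetting.contMDiff B).of_le (by norm_cast)

/-- **The flow-out preserves the unstable sets**: a boundary point lies on the trajectory coming
from `p` iff its flow-out does (transport along the trajectory segment joining them, both ways).
[cite: MilnorHCobordism1965, Def. 3.9 (PDF p. 16)] -/
theorem coe_mem_unstableSet_iff_Fl (y : (𝓡∂ (n + 1)).boundary W) {t : ℝ} (ht : t ∈ Icc 0 B.S.a')
    (p : W) :
    (y : W) ∈ unstableSet (𝓡∂ (n + 1)) ξ p ↔ B.Fl (y : W) t ∈ unstableSet (𝓡∂ (n + 1)) ξ p := by
  have h := B.flowsTo_Fl_coe y ht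
  constructor
  · intro hy
    rw [unstableSet_eq_stableSet_neg] at hy ⊢
    exact h.reverse.mem_stableSet_right B.S.contMDiff_one hy
  · intro hp
    exact h.mem_unstableSet_right hp

/-- **The push preserves the unstable sets.** [cite: MilnorHCobordism1965, Def. 3.9 (PDF p. 16)] -/
theorem coe_mem_unstableSet_iff (y : (𝓡∂ (n + 1)).boundary W) (p : W) :
    (y : W) ∈ unstableSet (𝓡∂ (n + 1)) ξ p ↔ B.push (y : W) ∈ unstableSet (𝓡∂ (n + 1)) ξ p := by
  rw [push_coe]; exact B.coe_mem_unstableSet_iff_Fl y B.κ_mem_Icc p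

end BasinSetting

end Literature.Topology.FourManifolds
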